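import Mathlib.NumberTheory.Padics.Complex
import Mathlib.Topology.LocallyConstant.Basic
import Mathlib.Topology.Instances.Matrix
import Mathlib.Topology.Algebra.MvPolynomial
import Mathlib.LinearAlgebra.Matrix.Charpoly.Univ
import Mathlib.Analysis.Normed.Group.Ultra
import Summits.Langlands.Langlands.Theorems.PhantomRMYoshidaResiduallyYoshidaLiftingCrossRegularDefs
import Literature.NumberTheory.GaloisRepresentations.FrobeniusDensity
import Literature.NumberTheory.Automorphic.ChebotarevArtinRepHolds
import Literature.NumberTheory.GaloisRepresentations.ResidualPairIntegrality
import Literature.NumberTheory.GaloisRepresentations.CompactImageCharpolyIntegral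
import Literature.NumberTheory.GaloisRepresentations.CyclotomicCharacterFrobeniusProofs
import HarnessLib

/-!
# Supply of cross-regular auxiliary primes (Chebotarev step)

Stub `stub_crossRegularSupply` (S2) of line `cross-regular-annihilator-primes` for the crux
`Summit.Langlands.Langlands.Theses.PhantomRMYoshida.ResiduallyYoshidaLifting` (stmt-Langlands-13639),
over the landed currency `Theorems/PhantomRMYoshidaResiduallyYoshidaLiftingCrossRegularDefs.lean`
(`Sh`, `ExactCross`, `QGood`, `CrossCongr`, `CrossRes`, `Gen` of namespace
`Summit.Langlands.Langlands.Cruxes.ResiduallyYoshidaLifting.CrossRegularAnnihilatorPrimes`).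

Let `p` be a prime, `k` a discrete field of characteristic `p`, `red : ℤ̄_p = 𝒪[ℚ̄_p] → k` a ring
map, `σ, σ' : Γ_ℚ → GL₂(k)` and `ρ₀, ρ : Γ_ℚ → GL₄(ℚ̄_p)` continuous with the crux's shape `Sh`
(in particular unramified at almost all places).  Suppose `im ρ` contains ONE exact cross-regular
element `γ` (`ExactCross σ σ' red ρ`): `det(X - ρ(γ)) = (X-a)(X-ea)(X-b)(X-eb)` with `e = ε_p(γ)`,
`e²ab = 1` in `ℤ̄_p`, `det(X - σ(γ)) = (X-ā)(X-ē b̄)`, `det(X - σ'(γ)) = (X-ē ā)(X-b̄)`, and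
`(ē, ā, b̄)` generic (`Gen`).  Then for every level `𝔫 ≠ 0`, every `m` and every depth `N` there is
a finite set `Q` of at least `m` finite places `v ∤ p𝔫` at which `ρ₀` is unramified and which are
admissible auxiliary places of depth `N` for `ρ` (`QGood σ σ' red 𝔫 ρ N v`: `ρ, σ, σ'` unramified,
`ρ(Frob_v)` ×-congruent mod `p^N` to `(X-a)(X-q_v a)(X-b')(X-q_v b')` with `q_v² a b' = 1`, and
`σ̄ ⊕ σ̄'(Frob_v)` cross-regular generic in the fixed cross position).

Proof (the Chebotarev step of Khare–Thorne style successive approximation, cf. Thorne 2016,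
Prop. 5.20 and Lemma 5.23 where complex conjugation plays the role of `γ`).  The set `U` of
`g ∈ Γ_ℚ` with `σ(g) = σ(γ)`, `σ'(g) = σ'(γ)`, `‖c_j(g) - c_j(γ)‖ < ‖p‖^{N+1}` for the coefficients
`c_j` of `det(X - ρ(·))` and `‖ε_p(g) - ε_p(γ)‖ < ‖p‖^{N+1}` is an open neighbourhood of `γ`
(`σ, σ'` are locally constant since `k` is discrete; the `c_j` are polynomials in the matrix entries,
Mathlib `Matrix.charpoly.univ`, hence continuous; `ε_p` is continuous).  The arithmetic Frobenii at
places outside any finite set `S` are dense in `Γ_ℚ` (`absoluteGaloisGroup.frobenius_dense`, from the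
proved Chebotarev theorem `Automorphic.chebotarev_artinRep_holds`); taking for `S` the places dividing
`p𝔫`, the finitely many exceptional places of `Sh ρ₀`, `Sh ρ`, and the (supposedly finite) set of
good places, one finds a Frobenius `g ∈ U` at a new place `v`, which is good — contradiction, so the
good places are infinite.  Goodness of such a `v` (`qGood_of_frob`): `ε_p(g) = q_v`
(`GaloisRep.cyclotomicCharacter_apply_of_isArithFrobAt`), so `q_v ≡ e (mod p^{N+1})` in `ℤ̄_p`
(`‖x‖ ≤ ‖p‖ⁿ ⟹ pⁿ ∣ x` in the valuation ring), hence `red e = q_v` and `q_v` is a unit; with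
`b' := (q_v² a)⁻¹` one has `b' ≡ b (mod p^{N+1})` and `red b' = red b`; the integral model `P` of
`det(X - ρ(g))` (`FramedGaloisRep.exists_charpoly_eq_map`) is the Frobenius polynomial at `v`
(`IsUnramifiedAt.hasFrobCharpolyAt_charpoly`) and is `≡ (X-a)(X-ea)(X-b)(X-eb) ≡
(X-a)(X-q_v a)(X-b')(X-q_v b')` coefficientwise (computed in `(ℤ̄_p/p^{N+1})[X]`); the residual
statements follow from `σ(g) = σ(γ)`, `σ'(g) = σ'(γ)`.

## References

* J. Thorne, *Automorphy of some residually dihedral Galois representations*, Math. Ann. 364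
  (2016), Prop. 5.20, Lemma 5.23. [Thorne2016]
* J.-P. Serre, *Abelian ℓ-adic representations and elliptic curves* (1968), Ch. I §2.2 Cor. 2 (a)
  (Frobenii are dense), §1.2 (the cyclotomic character). [SerreAbelianLadic1968]
-/

noncomputable section

-- `Summit.Langlands.Langlands.…` (summit = sub-problem name, D-0017 layout) trips `dupNamespace` on every decl.
set_option linter.dupNamespace false

open Field IsDedekindDomain Filter Topology Polynomial
open scoped NumberField Valued

namespace Summit.Langlands.Langlands.Cruxes.ResiduallyYoshidaLifting.CrossRegularAnnihilatorPrimes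

open Literature.NumberTheory.GaloisRepresentations

section Helpers

variable {p : ℕ} [Fact p.Prime]

/-- `‖p‖ = p⁻¹` in `ℚ̄_p`. [folklore] -/
private theorem norm_p_eq : ‖(p : PadicAlgCl p)‖ = (p : ℝ)⁻¹ := by
  rw [← map_natCast (algebraMap ℚ_[p] (PadicAlgCl p)) p, norm_algebraMap', Padic.norm_p]

/-- `0 < ‖p‖ < 1` in `ℚ̄_p`. [folklore] -/
private theorem norm_p_pos_lt_one : 0 < ‖(p : PadicAlgCl p)‖ ∧ ‖(p : PadicAlgCl p)‖ < 1 := by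
  have hp : (1 : ℝ) < p := by exact_mod_cast (Fact.out : p.Prime).one_lt
  rw [norm_p_eq]
  exact ⟨inv_pos.2 (zero_lt_one.trans hp), inv_lt_one_of_one_lt₀ hp⟩

/-- `‖x‖ ≤ ‖p‖ ^ n` in `ℚ̄_p` means `p ^ n ∣ x` in the valuation ring `ℤ̄_p`. [folklore] -/
private theorem pow_dvd_of_norm_le {x : 𝒪[PadicAlgCl p]} {n : ℕ}
    (h : ‖(x : PadicAlgCl p)‖ ≤ ‖(p : PadicAlgCl p)‖ ^ n) : (p : 𝒪[PadicAlgCl p]) ^ n ∣ x := by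
  refine (Valuation.integer.integers (Valued.v (R := PadicAlgCl p))).dvd_of_le ?_
  change ‖(x : PadicAlgCl p)‖₊ ≤ ‖(((p : 𝒪[PadicAlgCl p]) ^ n : 𝒪[PadicAlgCl p]) : PadicAlgCl p)‖₊
  push_cast
  rw [nnnorm_pow]
  exact_mod_cast h

/-- A unit of `ℤ̄_p` has norm `1`. [folklore] -/
private theorem norm_eq_one_of_isUnit {x : 𝒪[PadicAlgCl p]} (h : IsUnit x) :
    ‖(x : PadicAlgCl p)‖ = 1 := by
  have h1 := (Valuation.integer.integers (Valued.v (R := PadicAlgCl p))).one_of_isUnit h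
  change ‖(x : PadicAlgCl p)‖₊ = 1 at h1
  rw [← coe_nnnorm, h1, NNReal.coe_one]

/-- An element of `ℤ̄_p` of norm `1` is a unit. [folklore] -/
private theorem isUnit_of_norm_eq_one {x : 𝒪[PadicAlgCl p]} (h : ‖(x : PadicAlgCl p)‖ = 1) :
    IsUnit x := by
  refine (Valuation.integer.integers (Valued.v (R := PadicAlgCl p))).isUnit_of_one' ?_
  change ‖(x : PadicAlgCl p)‖₊ = 1
  exact NNReal.coe_injective (by rw [coe_nnnorm, h, NNReal.coe_one])

/-- Inverses are unique: if `f q = f e`, `e² a b = 1` and `q² a b' = 1` then `f b = f b'`.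
[folklore] -/
private theorem map_eq_of_inv {R S : Type*} [CommRing R] [CommRing S] (f : R →+* S)
    {q e a b b' : R} (hqe : f q = f e) (hb : e ^ 2 * a * b = 1) (hb' : q ^ 2 * a * b' = 1) :
    f b = f b' := by
  have h3 : f (q ^ 2 * a) = f (e ^ 2 * a) := by simp only [map_mul, map_pow, hqe]
  have h1 : f b * f (q ^ 2 * a) = 1 := by rw [h3, ← map_mul, mul_comm b, hb, map_one]
  have h2 : f (q ^ 2 * a) * f b' = 1 := by rw [← map_mul, hb', map_one]
  exact left_inv_eq_right_inv h1 h2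

/-- Coefficientwise divisibility by `x` is equality of the images in `(R ⧸ x)[X]`. [folklore] -/
private theorem forall_dvd_coeff_sub_iff {R : Type*} [CommRing R] (x : R) (A B : R[X]) :
    (∀ j, x ∣ (A - B).coeff j) ↔
      A.map (Ideal.Quotient.mk (Ideal.span {x})) = B.map (Ideal.Quotient.mk (Ideal.span {x})) := by
  rw [← sub_eq_zero, ← Polynomial.map_sub, Polynomial.ext_iff]
  refine forall_congr' fun j => ?_
  rw [Polynomial.coeff_map, Polynomial.coeff_zero, Ideal.Quotient.eq_zero_iff_mem,
    Ideal.mem_span_singleton]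

/-- The coefficients of the characteristic polynomial depend continuously on the matrix (they are
polynomials in the entries: Mathlib `Matrix.charpoly.univ`). [folklore] -/
private theorem continuous_charpoly_coeff {X A : Type*} [TopologicalSpace X] [CommRing A]
    [TopologicalSpace A] [IsTopologicalRing A] {n : Type*} [Fintype n] [DecidableEq n]
    {f : X → Matrix n n A} (hf : Continuous f) (i : ℕ) :
    Continuous fun x => (f x).charpoly.coeff i := by
  have h : (fun x => (f x).charpoly.coeff i) = fun x =>
      MvPolynomial.eval (fun ij : n × n => f x ij.1 ij.2) ((Matrix.charpoly.univ A n).coeff i) := by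
    funext x
    exact (Matrix.charpoly.univ_coeff_eval₂Hom n (RingHom.id A) (fun ij : n × n => f x ij.1 ij.2) i).symm
  rw [h]
  exact (MvPolynomial.continuous_eval _).comp (continuous_pi fun ij => hf.matrix_elem ij.1 ij.2)

end Helpers

section Local

variable {p : ℕ} [Fact p.Prime] {k : Type} [Field k] [CharP k p] [TopologicalSpace k]
  [DiscreteTopology k]

/-- **The local step at an auxiliary Frobenius.**  Let `v ∤ p𝔫` be a place at which `ρ, σ, σ'` are
unramified, `g` an arithmetic Frobenius at `𝔓 ∣ v`, and suppose: `e² a b = 1` in `ℤ̄_p` with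
`(ē, ā, b̄)` generic, `q_v ≡ e (mod p^{N+1})` (as `‖q_v - e‖ < ‖p‖^{N+1}`), the integral model `P` of
`det(X - ρ(g))` is coefficientwise `≡ (X-a)(X-ea)(X-b)(X-eb) (mod p^{N+1})`, and
`det(X - σ(g)) = (X-ā)(X-ē b̄)`, `det(X - σ'(g)) = (X-ē ā)(X-b̄)`.  Then `v` is an admissible
auxiliary place of depth `N` (`QGood`), with `b' := (q_v² a)⁻¹`: `q_v` is a unit (`‖q_v‖ = ‖e‖ = 1`,
all triangles are isosceles), `b' ≡ b (mod p^{N+1})` and `red b' = red b`, `red e = q_v` (`red` kills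
`p`), and products of congruent linear factors are congruent (computed in `(ℤ̄_p / p^{N+1})[X]`).
[cite: Thorne2016, Prop. 5.20 and Lemma 5.23] -/
private theorem qGood_of_frob (red : 𝒪[PadicAlgCl p] →+* k) {σ σ' : FramedGaloisRep ℚ k 2}
    {ρ : FramedGaloisRep ℚ (PadicAlgCl p) 4} {𝔫 : Ideal (𝓞 ℚ)} {N : ℕ} {v : HeightOneSpectrum (𝓞 ℚ)}
    (h𝔫v : ¬ v.asIdeal ∣ 𝔫) (hpv : ((p : ℕ) : 𝓞 ℚ) ∉ v.asIdeal) (hρv : ρ.IsUnramifiedAt v)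
    (hσv : σ.IsUnramifiedAt v) (hσ'v : σ'.IsUnramifiedAt v) {𝔓 : Ideal (absIntegers (𝓞 ℚ) ℚ)}
    (h𝔓 : 𝔓 ∈ v.primesAbove) {g : absoluteGaloisGroup ℚ} (hg : IsArithFrobAt (𝓞 ℚ) g 𝔓)
    {a b e : 𝒪[PadicAlgCl p]} (hab : e ^ 2 * a * b = 1) (hgen : Gen (red e) (red a) (red b))
    (hqe : ‖(v.residueCard : PadicAlgCl p) - (e : PadicAlgCl p)‖ < ‖(p : PadicAlgCl p)‖ ^ (N + 1))
    {P : Polynomial 𝒪[PadicAlgCl p]}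
    (hP : P.map (𝒪[PadicAlgCl p]).subtype = FramedRep.charpoly ρ g)
    (hPγ : ∀ j, (p : 𝒪[PadicAlgCl p]) ^ (N + 1) ∣
      (P - (X - C a) * (X - C (e * a)) * (X - C b) * (X - C (e * b))).coeff j)
    (hσg : FramedRep.charpoly σ g = (X - C (red a)) * (X - C (red e * red b)))
    (hσ'g : FramedRep.charpoly σ' g = (X - C (red e * red a)) * (X - C (red b))) :
    QGood σ σ' red 𝔫 ρ N v := by
  have hp01 := norm_p_pos_lt_one (p := p)
  -- `q ≡ e (mod p^{N+1})`, hence `red e = q`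
  have heq : (p : 𝒪[PadicAlgCl p]) ^ (N + 1) ∣ (v.residueCard : 𝒪[PadicAlgCl p]) - e :=
    pow_dvd_of_norm_le (by push_cast; exact hqe.le)
  have hre : red e = (v.residueCard : k) := by
    obtain ⟨t, ht⟩ := (dvd_pow_self (p : 𝒪[PadicAlgCl p]) (Nat.succ_ne_zero N)).trans heq
    have h0 : red ((v.residueCard : 𝒪[PadicAlgCl p]) - e) = 0 := by
      rw [ht, map_mul, map_natCast, CharP.cast_eq_zero k p, zero_mul]
    rw [map_sub, sub_eq_zero, map_natCast] at h0
    exact h0.symm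
  -- `a`, `e`, `q` are units of `ℤ̄_p`
  have ha : IsUnit a := IsUnit.of_mul_eq_one (e ^ 2 * b) (by rw [← hab]; ring)
  have he1 : ‖(e : PadicAlgCl p)‖ = 1 :=
    norm_eq_one_of_isUnit (IsUnit.of_mul_eq_one (e * a * b) (by rw [← hab]; ring))
  have hq1 : ‖(v.residueCard : PadicAlgCl p)‖ = 1 := by
    have hlt : ‖(v.residueCard : PadicAlgCl p) - e‖ < 1 :=
      hqe.trans_le (pow_le_one₀ (norm_nonneg _) hp01.2.le)
    have hne : ‖(e : PadicAlgCl p)‖ ≠ ‖(v.residueCard : PadicAlgCl p) - e‖ := by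
      rw [he1]; exact (ne_of_lt hlt).symm
    have h := IsUltrametricDist.norm_add_eq_max_of_norm_ne_norm hne
    rwa [add_sub_cancel, he1, max_eq_left hlt.le] at h
  have hqu : IsUnit (v.residueCard : 𝒪[PadicAlgCl p]) :=
    isUnit_of_norm_eq_one (by push_cast; exact hq1)
  -- `b' := (q² a)⁻¹`
  obtain ⟨u, hu⟩ := (hqu.pow 2).mul ha
  obtain ⟨b', hb'⟩ : ∃ b' : 𝒪[PadicAlgCl p], b' = (u⁻¹ : (𝒪[PadicAlgCl p])ˣ) := ⟨_, rfl⟩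
  have hab' : (v.residueCard : 𝒪[PadicAlgCl p]) ^ 2 * a * b' = 1 := by rw [← hu, hb', Units.mul_inv]
  -- `red b = red b'` and `b ≡ b' (mod p^{N+1})`
  have hrq : red (v.residueCard : 𝒪[PadicAlgCl p]) = red e := by rw [map_natCast, hre]
  have hrb : red b = red b' := map_eq_of_inv red hrq hab hab'
  obtain ⟨I, hI⟩ : ∃ I : Ideal 𝒪[PadicAlgCl p], Ideal.span {(p : 𝒪[PadicAlgCl p]) ^ (N + 1)} = I :=
    ⟨_, rfl⟩
  have hmq : Ideal.Quotient.mk I e = Ideal.Quotient.mk I (v.residueCard : 𝒪[PadicAlgCl p]) := by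
    rw [← hI]
    exact (Ideal.Quotient.eq.2 (Ideal.mem_span_singleton.2 heq)).symm
  have hmb : Ideal.Quotient.mk I b = Ideal.Quotient.mk I b' := map_eq_of_inv _ hmq.symm hab hab'
  -- the ×-congruence mod `p^{N+1}`
  have hcong : ∀ j, (p : 𝒪[PadicAlgCl p]) ^ (N + 1) ∣ (P - (X - C a) *
      (X - C ((v.residueCard : 𝒪[PadicAlgCl p]) * a)) * (X - C b') *
        (X - C ((v.residueCard : 𝒪[PadicAlgCl p]) * b'))).coeff j := by
    have h1 := (forall_dvd_coeff_sub_iff _ _ _).1 hPγ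
    rw [hI] at h1
    rw [forall_dvd_coeff_sub_iff, hI, h1]
    simp only [Polynomial.map_mul, Polynomial.map_sub, Polynomial.map_X, Polynomial.map_C, map_mul,
      hmq, hmb]
  refine ⟨h𝔫v, hpv, hρv, hσv, hσ'v, a, b', ⟨P, ?_, hab', fun j => ?_⟩, ?_, ?_, ?_⟩
  · rw [hP]
    exact hρv.hasFrobCharpolyAt_charpoly h𝔓 hg
  · exact (pow_dvd_pow (p : 𝒪[PadicAlgCl p]) N.le_succ).trans (hcong j)
  · have h := hσv.hasFrobCharpolyAt_charpoly h𝔓 hg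
    rwa [hσg, hre, hrb] at h
  · have h := hσ'v.hasFrobCharpolyAt_charpoly h𝔓 hg
    rwa [hσ'g, hre, hrb] at h
  · rw [← hre, ← hrb]
    exact hgen

end Local

/-- **Stub S2 (supply of cross-regular auxiliary primes; Chebotarev).**  From ONE exact cross-regular
element `γ ∈ Γ_ℚ` of `im ρ` (`ExactCross σ σ' red ρ`: `det(X - ρ(γ)) = (X-a)(X-ea)(X-b)(X-eb)` with
`e = ε_p(γ)`, `e²ab = 1`, residually in cross position and generic) one gets, for every level `𝔫 ≠ 0`,
every `m` and every depth `N`, a set `Q` of at least `m` finite places `v ∤ p𝔫` at which `ρ₀, ρ, σ, σ'`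
are unramified and `ρ(Frob_v)` is ×-congruent mod `p^N` with residually cross-regular generic reduction
(`QGood`).  Proof (Khare–Thorne style successive approximation, Chebotarev step): the set `U` of `g ∈ Γ_ℚ`
with `σ(g) = σ(γ)`, `σ'(g) = σ'(γ)`, `det(X - ρ(g)) ≡ det(X - ρ(γ))` coefficientwise to precision
`‖p‖^{N+1}` and `ε_p(g) ≡ ε_p(γ) (mod p^{N+1})` is an open neighbourhood of `γ` (`σ, σ'` are locally
constant, the coefficients of `det(X - ρ(g))` and `ε_p` are continuous); arithmetic Frobenii at places
outside any finite set are dense (`absoluteGaloisGroup.frobenius_dense` from the proved Chebotarev theorem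
`chebotarev_artinRep_holds`), so infinitely many places `v ∤ p𝔫`, unramified for `ρ₀, ρ, σ, σ'`, carry a
Frobenius `g ∈ U`; at such `v`, `ε_p(g) = q_v` (`GaloisRep.cyclotomicCharacter_apply_of_isArithFrobAt`),
the Frobenius polynomials are `det(X - ρ(g))` (integral: `FramedGaloisRep.exists_charpoly_eq_map`),
`det(X - σ(g))`, `det(X - σ'(g))` (`IsUnramifiedAt.hasFrobCharpolyAt_charpoly`), and the local step
`qGood_of_frob` applies. [cite: Thorne2016, Prop. 5.20 and Lemma 5.23] -/
theorem stub_crossRegularSupply : ∀ (p : ℕ) [Fact p.Prime], p ≠ 2 → ∀ (k : Type) [Field k] [CharP k p] [IsAlgClosed k] [TopologicalSpace k] [DiscreteTopology k] (red : Valued.integer (PadicAlgCl p) →+* k) (σ σ' : Literature.NumberTheory.GaloisRepresentations.FramedGaloisRep ℚ k 2) (hcpt : Literature.NumberTheory.Automorphic.isCompact_glFiniteIntegralLevel 4 ℚ) (ι : PadicAlgCl p ≃+* ℂ) (ρ₀ ρ : Literature.NumberTheory.GaloisRepresentations.FramedGaloisRep ℚ (PadicAlgCl p) 4), Summit.Langlands.Langlands.Cruxes.ResiduallyYoshidaLifting.CrossRegularAnnihilatorPrimes.Sh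 σ σ' red ρ₀ → Summit.Langlands.Langlands.Cruxes.ResiduallyYoshidaLifting.CrossRegularAnnihilatorPrimes.Sh σ σ' red ρ → Summit.Langlands.Langlands.Cruxes.ResiduallyYoshidaLifting.CrossRegularAnnihilatorPrimes.ExactCross σ σ' red ρ → ∀ (𝔫 : Ideal (NumberField.RingOfIntegers ℚ)), 𝔫 ≠ 0 → ∀ (m N : ℕ), ∃ Q : Finset (IsDedekindDomain.HeightOneSpectrum (NumberField.RingOfIntegers ℚ)), m ≤ Q.card ∧ ∀ v ∈ Q, ρ₀.IsUnramifiedAt v ∧ Summit.Langlands.Langlands.Cruxes.ResiduallyYoshidaLifting.CrossRegularAnnihilatorPrimes.QGood σ σ' red 𝔫 ρ N v := by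
  intro p _ _ k _ _ _ _ _ red σ σ' _ _ ρ₀ ρ hρ₀ hρ hX 𝔫 h𝔫 m N
  obtain ⟨γ, a, b, e, he, hab, hργ, hσγ, hσ'γ, hgen⟩ := hX
  obtain ⟨-, -, hρ₀ae⟩ := hρ₀
  obtain ⟨-, -, hρae⟩ := hρ
  have hp01 := norm_p_pos_lt_one (p := p)
  -- it suffices to show that the set of good places is infinite
  set G : Set (HeightOneSpectrum (𝓞 ℚ)) := {v | ρ₀.IsUnramifiedAt v ∧ QGood σ σ' red 𝔫 ρ N v} with hG
  suffices hinf : G.Infinite by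
    obtain ⟨Q, hQ, hcard⟩ := hinf.exists_subset_card_eq m
    exact ⟨Q, hcard.ge, fun v hv => hQ (Finset.mem_coe.2 hv)⟩
  intro hfin
  -- the finite exceptional set `S`
  have h𝔫' : 𝔫 ≠ ⊥ := by rwa [Ne, ← Ideal.zero_eq_bot]
  have hp0 : Ideal.span {((p : ℕ) : 𝓞 ℚ)} ≠ ⊥ := by
    rw [Ne, Ideal.span_singleton_eq_bot]
    exact_mod_cast (Fact.out : p.Prime).ne_zero
  set S : Set (HeightOneSpectrum (𝓞 ℚ)) := {v | v.asIdeal ∣ 𝔫} ∪ {v | ((p : ℕ) : 𝓞 ℚ) ∈ v.asIdeal} ∪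
    {v | ¬ (ρ₀.IsUnramifiedAt v ∧ σ.IsUnramifiedAt v ∧ σ'.IsUnramifiedAt v ∧
      ∃ (P : Polynomial (Valued.integer (PadicAlgCl p))) (P₁ P₂ : Polynomial k),
        ρ₀.HasFrobCharpolyAt v (P.map (Valued.integer (PadicAlgCl p)).subtype) ∧
        σ.HasFrobCharpolyAt v P₁ ∧ σ'.HasFrobCharpolyAt v P₂ ∧ P.map red = P₁ * P₂)} ∪
    {v | ¬ (ρ.IsUnramifiedAt v ∧ σ.IsUnramifiedAt v ∧ σ'.IsUnramifiedAt v ∧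
      ∃ (P : Polynomial (Valued.integer (PadicAlgCl p))) (P₁ P₂ : Polynomial k),
        ρ.HasFrobCharpolyAt v (P.map (Valued.integer (PadicAlgCl p)).subtype) ∧
        σ.HasFrobCharpolyAt v P₁ ∧ σ'.HasFrobCharpolyAt v P₂ ∧ P.map red = P₁ * P₂)} ∪ G with hS
  have hS₀ : S.Finite := by
    refine ((((Ideal.finite_factors h𝔫').union ((Ideal.finite_factors hp0).subset ?_)).union
      (Filter.eventually_cofinite.1 hρ₀ae)).union (Filter.eventually_cofinite.1 hρae)).union hfin
    exact fun v hv => Ideal.dvd_span_singleton.2 hv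
  have hD := absoluteGaloisGroup.frobenius_dense
    Literature.NumberTheory.Automorphic.chebotarev_artinRep_holds ℚ S hS₀
  -- the open neighbourhood `U` of `γ`
  set r : ℝ := ‖(p : PadicAlgCl p)‖ ^ (N + 1) with hr
  have hr0 : 0 < r := pow_pos hp01.1 _
  set χ : absoluteGaloisGroup ℚ → ℤ_[p] :=
    fun g => ((GaloisRep.cyclotomicCharacter ℚ p g : ℤ_[p]ˣ) : ℤ_[p]) with hχ
  have hχc : Continuous χ := Units.continuous_val.comp (map_continuous _)
  have hcc : ∀ j, Continuous fun g : absoluteGaloisGroup ℚ => (FramedRep.charpoly ρ g).coeff j :=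
    fun j => continuous_charpoly_coeff (Units.continuous_val.comp (map_continuous ρ)) j
  have hσl : IsLocallyConstant (σ : absoluteGaloisGroup ℚ → GL (Fin 2) k) :=
    (IsLocallyConstant.iff_continuous _).2 (map_continuous σ)
  have hσ'l : IsLocallyConstant (σ' : absoluteGaloisGroup ℚ → GL (Fin 2) k) :=
    (IsLocallyConstant.iff_continuous _).2 (map_continuous σ')
  set U : Set (absoluteGaloisGroup ℚ) := {g | σ g = σ γ} ∩ {g | σ' g = σ' γ} ∩
    (⋂ j ∈ Finset.range 5, {g | ‖(FramedRep.charpoly ρ g).coeff j - (FramedRep.charpoly ρ γ).coeff j‖ < r}) ∩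
    {g | ‖χ g - χ γ‖ < r} with hU
  have hUo : IsOpen U :=
    (((hσl.isOpen_fiber _).inter (hσ'l.isOpen_fiber _)).inter (isOpen_biInter_finset fun j _ =>
      isOpen_lt ((hcc j).sub continuous_const).norm continuous_const)).inter
      (isOpen_lt (hχc.sub continuous_const).norm continuous_const)
  have hγU : γ ∈ U := by
    refine ⟨⟨⟨rfl, rfl⟩, Set.mem_iInter₂.2 fun j _ => ?_⟩, ?_⟩
    · show ‖_ - _‖ < r
      rwa [sub_self, norm_zero]
    · show ‖_ - _‖ < r
      rwa [sub_self, norm_zero]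
  -- a Frobenius `g ∈ U` at a place `v ∉ S`
  obtain ⟨g, hgU, v, hvS, 𝔓, h𝔓, hg⟩ := hD.inter_open_nonempty U hUo ⟨γ, hγU⟩
  obtain ⟨⟨⟨hg₁, hg₂⟩, hg₃⟩, hg₄⟩ := hgU
  simp only [hS, Set.mem_union, Set.mem_setOf_eq, not_or, not_not] at hvS
  obtain ⟨⟨⟨⟨h𝔫v, hpv⟩, hρ₀v, -⟩, hρv, hσv, hσ'v, -⟩, hvG⟩ := hvS
  refine hvG ⟨hρ₀v, ?_⟩
  -- the hypotheses of the local step at `g`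
  have hcoef : ∀ j, ‖(FramedRep.charpoly ρ g).coeff j - (FramedRep.charpoly ρ γ).coeff j‖ < r := by
    intro j
    by_cases hj : j < 5
    · exact Set.mem_iInter₂.1 hg₃ j (Finset.mem_range.2 hj)
    · have h0 : ∀ x : absoluteGaloisGroup ℚ, (FramedRep.charpoly ρ x).coeff j = 0 := fun x =>
        Polynomial.coeff_eq_zero_of_natDegree_lt (by
          unfold FramedRep.charpoly
          rw [Matrix.charpoly_natDegree_eq_dim, Fintype.card_fin]; omega)
      rw [h0, h0, sub_self, norm_zero]
      exact hr0
  obtain ⟨P, hP⟩ := FramedGaloisRep.exists_charpoly_eq_map ρ g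
  have hPi : ((X - C a) * (X - C (e * a)) * (X - C b) * (X - C (e * b))).map (𝒪[PadicAlgCl p]).subtype =
      FramedRep.charpoly ρ γ := by
    show _ = (ρ γ).val.charpoly
    rw [hργ]
    simp only [Polynomial.map_mul, Polynomial.map_sub, Polynomial.map_X, Polynomial.map_C,
      Subring.coe_subtype, Subring.coe_mul]
  have hPγ : ∀ j, (p : 𝒪[PadicAlgCl p]) ^ (N + 1) ∣
      (P - (X - C a) * (X - C (e * a)) * (X - C b) * (X - C (e * b))).coeff j := by
    intro j
    refine pow_dvd_of_norm_le ?_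
    have h1 : (((P - (X - C a) * (X - C (e * a)) * (X - C b) * (X - C (e * b))).coeff j :
        𝒪[PadicAlgCl p]) : PadicAlgCl p) =
        (FramedRep.charpoly ρ g).coeff j - (FramedRep.charpoly ρ γ).coeff j := by
      rw [← hP, ← hPi, Polynomial.coeff_map, Polynomial.coeff_map, Polynomial.coeff_sub]
      rfl
    rw [h1]
    exact (hcoef j).le
  have hσg : FramedRep.charpoly σ g = (X - C (red a)) * (X - C (red e * red b)) := by
    show (σ g).val.charpoly = _
    rw [hg₁, hσγ]
  have hσ'g : FramedRep.charpoly σ' g = (X - C (red e * red a)) * (X - C (red b)) := by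
    show (σ' g).val.charpoly = _
    rw [hg₂, hσ'γ]
  have hfrob : χ g = (v.residueCard : ℤ_[p]) :=
    GaloisRep.cyclotomicCharacter_apply_of_isArithFrobAt hpv h𝔓 hg
  have hqe : ‖(v.residueCard : PadicAlgCl p) - (e : PadicAlgCl p)‖ < r := by
    have h1 : (v.residueCard : PadicAlgCl p) - (e : PadicAlgCl p) =
        algebraMap ℚ_[p] (PadicAlgCl p) (((v.residueCard : ℤ_[p]) - χ γ : ℤ_[p]) : ℚ_[p]) := by
      rw [he, PadicInt.coe_sub, map_sub, PadicInt.coe_natCast, map_natCast]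
    rw [h1, norm_algebraMap', ← PadicInt.norm_def, ← hfrob]
    exact hg₄
  exact qGood_of_frob red h𝔫v hpv hρv hσv hσ'v h𝔓 hg hab hgen hqe hP hPγ hσg hσ'g

end Summit.Langlands.Langlands.Cruxes.ResiduallyYoshidaLifting.CrossRegularAnnihilatorPrimes

end
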